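import Summits.QuantumFields.YangMills.Theorems.UnitScaleTiltProp7CoerciveOfNormG0Comb
import Literature.MathematicalPhysics.QuantumFieldTheory.Balaban1983to89.T3PrintedMinimiserExistence
import HarnessLib

/-!
# Route `UnitScaleTilt`, crux K1 «MinimiserStabilityRegPr» (stmt-QuantumFields-19200) — ARCHITECTURE (A′)-on-Σ, THE E2E's CELLS 1–2 AT THE COMB SLOTS OF RECORD:
# **the (COERC) and (LANDAU) cells of ★p1 g17's half-way door ✓`Prop7HcoSOfMemberRows.hcoS_of_memberRowsS` (`hRows`), in ITS quantifier shape `∀ L>1 ∃ e₀ B₀>0 ∀ F n<K e V W X …`,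
# at `(Δx, Rr, Qc) := (DeltaEtaSlot, RcombL2, Qkc)`, from ONE displayed N06 row `norm_G₀ᶜ` (right-inverse form at the comb slots) — nothing else displayed**

Cell `ym3-torus` ∕ width seat `ym-ust-19200-w1` (gen 14).  THEOREMS ONLY (0 `def`, 0 `sorry`); `--supports stmt-QuantumFields-19200 --as helper`, count-neutral.
YM₃ on T³ is a ladder rung (R3), not d = 4, not infinite volume, not the Clay problem; nothing here claims the stub, the crux, `hcoS`, [B9] Thm 3.11 ∕ 3.3 or the gap — `norm_G₀ᶜ` stays DISPLAYED
(N06; flat-member certificate CLASS-LEVEL with the open certificate A6ᶜ, ★★OWNER RULINGS g29-№17∕№18).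

WHY (★p1 g17 ■ FINAL 04:11Z «NEXT SEAT (E′ namer g18): type `…HcoSEndToEnd.lean` `hcoS_of_N06 := hcoS_of_memberRowsS c₀ aQ DeltaEtaSlot (RcombL2) (Qkc) ⟨rows by name⟩`»).  The half-way door's
hypothesis `hRows` asks, per `L > 1` and `B₁′ > 0`, for L-only constants `e₀ B₀ kK kE kQ kQ′ C₁ C₂ ζ δ₁` and then, at every member `W ∈ (6)(e) ∩ 𝔅_k(V)`, `e ≤ e₀`, and every Σ-representative
`X` (`In19`, `AvgCondPrint`, `IsLandauPrint`), five cells.  This file delivers the first two — (COERC) `∀ y, B₀⁻¹‖y‖² ≤ re⟪y, Δ_a(W) y⟫` and (LANDAU) `Rr W (D*_W X̃) = 0` — EXACTLY in that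
shape at the slots of record, from the single displayed N06 row `norm_G₀ᶜ` read in the door's own `laplaceAK` letter («for `W ∈ 𝔘_k(α₀)` a right inverse `G₀` of `Δ_aᶜ(W)` with
`‖G₀ f‖ ≤ B₀‖f‖`», [Balaban1985BackgroundPropagators] Thm 3.11 + Thm 3.3 (3.46)–(3.47) class; ★p1 WORD 14's right-inverse form, comb instance): the radius is
`e₀ := min α₀ (min (1030·B₀)⁻¹ (min (c₂′(3,L)∕4) (6·C₀(3))⁻¹))` (L-only), the member's `RegPr e W` is read off `regFibrePr` (lit ✓`mem_regFibrePr_iff`) and lifted to `α₀` by lit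
✓`T3PrintedMinimiserExistence.regPr_mono`, and the two cells are ✓`Prop7CoerciveOfNormG0Comb.coerc_landau_RcombL2_of_normG₀_of_isLandauPrint` (w4 g8's T1∕T2 ∘ [B-Avg] Prop. 2 unitarity ∘
w1's LANDAU-COMB dictionary).  The E2E `min`s this `e₀` with the other cells' radii (the conclusion holds for every `e ≤ e₀`).

WHAT IS PROVED (ns `…Theorems.Prop7SigmaCellsCoercLandauComb`): `radius_windows` (the three numeral windows at `e ≤ e₀`), ★★★`coercLandauCells_of_normG₀Comb`.
HONEST SCOPE.  Composition + real arithmetic over landed theorems; no estimate; `norm_G₀ᶜ` is a HYPOTHESIS (displayed N06 row), not proved; nothing of (A′) ∕ E′ ∕ EX ∕ the crux claimed.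

References: T. Bałaban, CMP **99** (1985) 389–434 [Balaban1985BackgroundPropagators] (Thm 3.3 p.399, Thm 3.11 p.416, (3.21) p.394, (3.26) p.395); CMP **102** (1985) 277–309 [Balaban1985Variational]
((21) p.281, (141)–(142) p.299); CMP **98** (1985) 17–51 [Balaban1985Averaging] (Prop. 2 (52)–(53) p.26).
-/

set_option autoImplicit false

noncomputable section

open scoped Matrix.Norms.L2Operator InnerProductSpace BigOperators

namespace Summit.QuantumFields.YangMills.Theorems.Prop7SigmaCellsCoercLandauComb

open Literature.MathematicalPhysics.QuantumFieldTheory.Balaban1983to89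
open Literature.MathematicalPhysics.QuantumFieldTheory.Balaban1983to89.T3ContinuumYM3Torus
open Literature.MathematicalPhysics.QuantumFieldTheory.Balaban1983to89.T3PrintedRegularMinimiser (RegPr regFibrePr mem_regFibrePr_iff)
open Literature.MathematicalPhysics.QuantumFieldTheory.Balaban1983to89.T3PrintedMinimiserExistence (regPr_mono)
open B7Prop2Explicit (C0 c2' C0_pos c2'_pos)
open B11Eq103H1Complex (BondL2K laplaceAK)
open Summit.QuantumFields.YangMills.Theorems.Prop7SectET3Transport (periodsT3)
open Summit.QuantumFields.YangMills.Theorems.Prop7SectET3HilbertLetters (W₂ toL2 DL2 DstarL2)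
open Summit.QuantumFields.YangMills.Theorems.Prop7SectET3WilsonHessian (DeltaEtaSlot)
open Summit.QuantumFields.YangMills.Theorems.Prop7SectET3CombLetters (Qkc)
open Summit.QuantumFields.YangMills.Theorems.Prop7SPrint (IsLandauPrint)
open Summit.QuantumFields.YangMills.Theorems.Prop7QprimeCombL2 (RcombL2)
open Summit.QuantumFields.YangMills.Theorems.Prop7CoerciveOfNormG0Comb (coerc_landau_RcombL2_of_normG₀_of_isLandauPrint)

/-- **THE THREE NUMERAL WINDOWS AT THE L-ONLY RADIUS**: for `e ≤ min α₀ (min (1030·B₀)⁻¹ (min (c₂′(3,L)∕4) (6·C₀(3))⁻¹))`: `e ≤ α₀`, `1029·e·B₀ < 1`, `C₀(3)·(2e) ≤ ⅓`, `4e ≤ c₂′(3,L)`.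
[bookkeeping; cite: Balaban1985Averaging, (52) p.26; Balaban1985BackgroundPropagators, Thm 3.11 p.416] -/
theorem radius_windows {L : ℕ} {α₀ B₀ e : ℝ} (hB₀ : 0 < B₀)
    (hle : e ≤ min α₀ (min (1030 * B₀)⁻¹ (min (c2' 3 L / 4) (6 * C0 3)⁻¹))) :
    e ≤ α₀ ∧ 1029 * e * B₀ < 1 ∧ C0 3 * (2 * e) ≤ 1 / 3 ∧ 4 * e ≤ c2' 3 L := by
  have h1 : e ≤ α₀ := hle.trans (min_le_left _ _)
  have h2 : e ≤ (1030 * B₀)⁻¹ := (hle.trans (min_le_right _ _)).trans (min_le_left _ _)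
  have h3 : e ≤ c2' 3 L / 4 := ((hle.trans (min_le_right _ _)).trans (min_le_right _ _)).trans (min_le_left _ _)
  have h4 : e ≤ (6 * C0 3)⁻¹ := ((hle.trans (min_le_right _ _)).trans (min_le_right _ _)).trans (min_le_right _ _)
  have hC := C0_pos 3
  refine ⟨h1, ?_, ?_, by linarith⟩
  · have hprod : 1030 * e * B₀ ≤ 1 := by
      calc 1030 * e * B₀ = (1030 * B₀) * e := by ring
        _ ≤ (1030 * B₀) * (1030 * B₀)⁻¹ := mul_le_mul_of_nonneg_left h2 (by positivity)
        _ = 1 := mul_inv_cancel₀ (by positivity)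
    nlinarith
  · have hprod : (6 * C0 3) * e ≤ 1 := by
      calc (6 * C0 3) * e ≤ (6 * C0 3) * (6 * C0 3)⁻¹ := mul_le_mul_of_nonneg_left h4 (by positivity)
        _ = 1 := mul_inv_cancel₀ (by positivity)
    nlinarith

variable (c₀ cB : ℕ → ℝ) [hc₀ : ∀ L : ℕ, Fact (0 < c₀ L)] [hcB : ∀ L : ℕ, Fact (0 < cB L)] (aQ : T3Family → ℕ → ℕ → ℝ)

/-- ★★★ **THE (COERC) AND (LANDAU) CELLS OF `hcoS_of_memberRowsS`'s `hRows`, AT THE COMB SLOTS OF RECORD, FROM `norm_G₀ᶜ` ALONE.**  Hypotheses: the member-scaled weight is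
non-negative (`0 ≤ aQ F n K`) and the displayed N06 row `norm_G₀ᶜ` in right-inverse form at `(Δx, Rr, Qc) := (DeltaEtaSlot, RcombL2, Qkc)` — «∀ L > 1 ∃ α₀ B₀ > 0 ∀ F (F.L = L) n < K W,
W ∈ 𝔘_k(α₀) → ∃ G₀, Δ_aᶜ(W) ∘ G₀ = id ∧ ‖G₀ f‖ ≤ B₀‖f‖» ([Balaban1985BackgroundPropagators] Thm 3.11 + Thm 3.3 class for print's comb pair; DISPLAYED, not proved).  Conclusion: for every
`L > 1` there are L-only `e₀ B₀ > 0` such that at every member `W ∈ (6)(e) ∩ 𝔅_k(V)` with `0 < e ≤ e₀` and every `X` with `IsLandauPrint F n K W X`: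
(COERC) `∀ y, B₀⁻¹‖y‖² ≤ re⟪y, laplaceAK (Δ^η W) (D_W) (RcombL2 W) (D*_W) (Qkc W) (Qkc W)† aQ y⟫` and (LANDAU) `RcombL2 W (D*_W X̃) = 0` — the door's cells 1–2 TOKEN FOR TOKEN at the slots
of record (the unused binders `V`, E–L, `In19`, `AvgCondPrint` of `hRows` are simply not needed by these two cells).
[cite: Balaban1985BackgroundPropagators, Thm 3.11 p.416, Thm 3.3 p.399, (3.21) p.394, (3.26) p.395; Balaban1985Variational, (21) p.281, (141)-(142) p.299; Balaban1985Averaging, Prop. 2 p.26] -/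
theorem coercLandauCells_of_normG₀Comb (haQ : ∀ (F : T3Family) (n K : ℕ), 0 ≤ aQ F n K)
    (hN06 : ∀ (L : ℕ), 1 < L → ∃ α₀ B₀ : ℝ, 0 < α₀ ∧ 0 < B₀ ∧
      ∀ (F : T3Family), F.L = L → ∀ (n K : ℕ) (hnK : n < K) (W : GaugeField (F.P K) 0 (Matrix.specialUnitaryGroup (Fin 2) ℂ)),
        RegPr F n K α₀ W →
          ∃ G₀ : BondL2K ℂ 3 (periodsT3 F K) (c₀ F.L) W₂ →ₗ[ℂ] BondL2K ℂ 3 (periodsT3 F K) (c₀ F.L) W₂,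
            laplaceAK (DeltaEtaSlot F n K (c₀ F.L) W) (DL2 F n K (c₀ F.L) W) (RcombL2 F n K (c₀ F.L) W) (DstarL2 F n K (c₀ F.L) W)
                (Qkc F n K hnK.le (c₀ F.L) (cB F.L) W) (LinearMap.adjoint (Qkc F n K hnK.le (c₀ F.L) (cB F.L) W)) ((aQ F n K : ℝ) : ℂ) ∘ₗ G₀ = LinearMap.id ∧
            ∀ f, ‖G₀ f‖ ≤ B₀ * ‖f‖) :
    ∀ (L : ℕ), 1 < L → ∃ e₀ B₀ : ℝ, 0 < e₀ ∧ 0 < B₀ ∧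
      ∀ (F : T3Family), F.L = L → ∀ (n K : ℕ) (hnK : n < K) (e : ℝ) (V : GaugeField (F.P n) 0 (Matrix.specialUnitaryGroup (Fin 2) ℂ))
        (W : GaugeField (F.P K) 0 (Matrix.specialUnitaryGroup (Fin 2) ℂ)) (X : PBond (F.P K) 0 → Matrix (Fin 2) (Fin 2) ℂ),
        0 < e → e ≤ e₀ → W ∈ regFibrePr F n K hnK.le e V → IsLandauPrint F n K W X →
          (∀ y : BondL2K ℂ 3 (periodsT3 F K) (c₀ F.L) W₂,
              B₀⁻¹ * ‖y‖ ^ 2 ≤ RCLike.re ⟪y, laplaceAK (DeltaEtaSlot F n K (c₀ F.L) W) (DL2 F n K (c₀ F.L) W) (RcombL2 F n K (c₀ F.L) W) (DstarL2 F n K (c₀ F.L) W)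
                (Qkc F n K hnK.le (c₀ F.L) (cB F.L) W) (LinearMap.adjoint (Qkc F n K hnK.le (c₀ F.L) (cB F.L) W)) ((aQ F n K : ℝ) : ℂ) y⟫_ℂ) ∧
          RcombL2 F n K (c₀ F.L) W (DstarL2 F n K (c₀ F.L) W (toL2 F K (c₀ F.L) X)) = 0 := by
  intro L hL
  obtain ⟨α₀, B₀, hα₀, hB₀, H⟩ := hN06 L hL
  have hL1 : 1 ≤ L := hL.le
  have hc2 : 0 < c2' 3 L := c2'_pos 3 L hL1
  have hC := C0_pos 3
  refine ⟨min α₀ (min (1030 * B₀)⁻¹ (min (c2' 3 L / 4) (6 * C0 3)⁻¹)), B₀, ?_, hB₀, ?_⟩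
  · exact lt_min hα₀ (lt_min (by positivity) (lt_min (by positivity) (by positivity)))
  intro F hF n K hnK e V W X he hle hWreg hLan
  obtain ⟨heα, hwin, hα3, hα4⟩ := radius_windows (L := L) hB₀ hle
  have hregE : RegPr F n K e W := ((mem_regFibrePr_iff F).1 hWreg).2
  have hregα : RegPr F n K α₀ W := regPr_mono F heα hregE
  obtain ⟨G₀, hG, hGB⟩ := H F hF n K hnK W hregα
  -- the windows in the member's letters `(F.P K).d = 3`, `(F.P K).L = F.L = L`
  have hα3' : C0 (F.P K).d * (2 * e) ≤ 1 / 3 := by rw [T3Family.P_d]; exact hα3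
  have hα4' : 4 * e ≤ c2' (F.P K).d (F.P K).L := by
    rw [T3Family.P_d, show (F.P K).L = L from hF ▸ rfl]; exact hα4
  exact coerc_landau_RcombL2_of_normG₀_of_isLandauPrint F hnK.le (c₀ F.L) (cB F.L) (aQ F n K) he hα3' hα4' W hregE (haQ F n K) hB₀ hwin G₀ hG hGB hLan

end Summit.QuantumFields.YangMills.Theorems.Prop7SigmaCellsCoercLandauComb

end
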